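import Summits.QuantumFields.YangMills.Theorems.DiagonalMirrorRPRDiagonalSliceModelDefs
import Literature.MathematicalPhysics.QuantumFieldTheory.WilsonAxisSymmetry

/-!
# Crux `WeakCouplingHypercubicLimitRP` (stmt-QuantumFields-27398), line `Sketch`, stub D1′ `stub_oddTorusSwapPairingLiminf`,
# door C (`cube-surgery-decoupling`, card #114): the FREE HYPERCUBE inside the scheme's own torus, its Wilson measure, the
# closed positive half of the diagonal site mirror `v = x₀ − x₁ = 0`, and the door-C letter `CubeDecoupling` — DEFINITIONS

Helper file (`--supports stmt-QuantumFields-27398 --as helper`) of the crux lead `lead-27398-D1` (gen 2, PICKED.md of record,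
`Cruxes/WeakCouplingHypercubicLimitRP/PICKED.md`): the vocabulary of door C for the registered lattice stub D1′
`stub_oddTorusSwapPairingLiminf` of `Cruxes/WeakCouplingHypercubicLimitRP/Lines/Sketch.lean` (v2, ρ1 reshape); it closes nothing by itself.

WHAT (re-homed from §1–§2 of the crux-ideate sketch `Sketch-stochastic-geometric.lean`, seat `cruxidea-…-10604-r2-stochastic-geometric`,
sha16 `4cc70957`, namespace `…Cruxes.DiagonalMirrorRPR.CubeSurgery` kept; bodies byte-for-byte except where noted):
* §1 the free hypercube `Q_R = {|x_μ| ≤ R}` INSIDE the scheme's own torus of side `S` (centred integer representatives `rep` =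
  `ZMod.valMinAbs`, so for `2R+1 ≤ S` nothing wraps): `PlaqInCube`, the free-cube Wilson action / weight / probability measure
  `cubeAction`, `cubeWeight`, `cubeMeasure` (plaquettes leaving `Q_R` DELETED, nothing else changed: same links, same Haar factors, same `β`,
  same representation), the closed positive half of the diagonal SITE mirror `v = x₀ − x₁ = 0` on links, `PosHalfEdge` (`dv` = the change of
  `v` along a direction), and `cubeLatticeSchwinger` (= `latticeSchwinger` with the cube measure: integrand, box, spacing, renormalisations
  VERBATIM);
* §2 the statements: `CubeHalfRP G` (S1a, fixed volume: the free hypercube bisected by the site mirror is EXACTLY swap-reflection-positive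
  for `β ≥ 0` — Fröhlich–Israel–Lieb–Simon site reflection with ONE mirror layer and a free far end; DEVIATION from the sketch: the swap of a
  torus configuration is the tree's `configPerm (Equiv.swap 0 1)` of `LatticeGaugeStaticPotentialProofs` §(B), pointwise equal to the sketch's
  `U ∘ swapEdge`, so that `WilsonAxisSymmetry` / `…WilsonDiagonalModelMirrorFamily` apply by name), `cubeGramPairing` (the free-cube twin of
  the interface's `gramPairing`, on a `ReflectedFamily` of `…DiagonalSliceModelDefs`), THE LETTER `CubeDecoupling r sch R` (torus-minus-cube
  Gram pairing of every pairwise-disjoint reflected family `→ 0`: thermodynamic-limit insensitivity of renormalised local curvature pairings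
  to a receding axis-aligned free boundary, in PHYSICAL units) and its packaging `AdmissibleCubeDecoupling r sch` (some radii `R_k ≤ L_k` with
  `a_k R_k → ∞` decouple).  The sketch's stochastic-geometric currency (`SeamClustering`, the monotone seam coupling `μ_t`) is not needed by
  the kernel composition and is left for the interpolation step.

WHY: the composition `D1′ ⟸ AdmissibleCubeDecoupling r (subseq sch φ hφ)` (door C's `pairingLiminf_of_cube` + S1a + S1b, files
`…DiagonalMirrorRPRCubeHalfRP`, `…PencilRigidityWeakCouplingHypercubicLimitRPOfCubeDecoupling`) must NAME the cube measure and the letter.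

HONEST FRAMING: vocabulary only (`def … : Prop` with parameters = PREDICATES on `(G)` / `(r, sch, R)`, the line's statements, NOT cited
facts and NOT restatements of any registered obligation).  Finite-`k` swap-RP is FALSE on the scheme's own tori
(`Theorems/DiagonalMirrorRPR/Negative/…`); the cube is the sub-geometry of the SAME lattice on which it is an identity.  `CubeDecoupling` at
weak coupling for non-abelian `G` is NOT proved anywhere (it is of infinite-volume-locality strength; Osterwalder–Seiler prove it at strong
coupling, Adhikari–Cao for finite `G` at large `β`).  Nothing is proved here; D1′, ⟨27398⟩ and its heart S6i are OPEN; the Yang–Mills mass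
gap is NOT proved here or anywhere in the tree.  No instance, no notation, `autoImplicit false`.

References: Fröhlich–Israel–Lieb–Simon, Comm. Math. Phys. 62 (1978) Thm 2.1; Osterwalder–Seiler, Ann. Phys. 110 (1978) §2–4; Seiler,
LNP 159 (1982) Ch. 2; A. Adhikari, S. Cao, arXiv:2202.10375 Thm 1.
-/

set_option autoImplicit false

noncomputable section

open scoped SchwartzMap
open MeasureTheory Filter Topology
open Literature.MathematicalPhysics.QuantumLattice Literature.MathematicalPhysics.AQFT
  Literature.MathematicalPhysics.QuantumFieldTheory
open Literature.Probability.LatticeModels (box)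
open Summit.QuantumFields.YangMills.Cruxes.DiagonalMirrorRPR.ParityBridgeColdTraces (E4)
open Summit.QuantumFields.YangMills.Cruxes.DiagonalMirrorRPR.SignTwistedDiagonalTrace (ReflectedFamily gramPairing)

namespace Summit.QuantumFields.YangMills.Cruxes.DiagonalMirrorRPR.CubeSurgery

/-! ## §1 The free hypercube inside the scheme's own torus -/

section Cube

/-- Centred integer representatives of a torus site (`ZMod.valMinAbs`, values in `(-S/2, S/2]`). -/
def rep (S : ℕ) (x : Site 4 S) : Fin 4 → ℤ := fun μ => (x μ).valMinAbs

/-- The plaquette `(x; i<j)` lies in the free hypercube `Q_R = [-R, R]⁴` WITHOUT WRAPPING: all coordinates of `x` in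
`[-R, R]` and `x_i + 1 ≤ R`, `x_j + 1 ≤ R` as integers (so for `2R+1 ≤ S` the cube is a genuine cube of `ℤ⁴`). -/
def PlaqInCube (S R : ℕ) (p : Plaquette 4 S) : Prop :=
  (∀ μ : Fin 4, |rep S p.1 μ| ≤ (R : ℤ)) ∧ rep S p.1 p.2.1.1 + 1 ≤ (R : ℤ) ∧ rep S p.1 p.2.1.2 + 1 ≤ (R : ℤ)

variable {G : Type} [Group G]

open Classical in
/-- The Wilson action of the free hypercube: `∑_{p ⊆ Q_R} (N − Re tr ρ(U_p))`, all other plaquettes of the torus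
DELETED (their links become Haar-free; nothing else is changed). -/
def cubeAction {N : ℕ} (ρ : G →* Matrix (Fin N) (Fin N) ℂ) (S R : ℕ) [NeZero S] (U : GaugeConfig 4 S G) : ℝ :=
  ∑ p : Plaquette 4 S, if PlaqInCube S R p then
    ((N : ℝ) - (ρ (plaquetteHolonomy U p.1 p.2.1.1 p.2.1.2)).trace.re) else 0

variable [TopologicalSpace G] [IsTopologicalGroup G] [CompactSpace G] [MeasurableSpace G] [BorelSpace G]

/-- The un-normalised free-cube weight `exp(−β S_{Q_R}(U)) ∏ₑ dU_e` on ALL links of the torus (pattern of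
`wilsonWeight`). -/
def cubeWeight {N : ℕ} (ρ : G →* Matrix (Fin N) (Fin N) ℂ) (β : ℝ) (S R : ℕ) [NeZero S] :
    Measure (GaugeConfig 4 S G) :=
  (Measure.pi fun _ : Edge 4 S => haarProbability G).withDensity
    fun U => ENNReal.ofReal (Real.exp (-β * cubeAction ρ S R U))

/-- The free-cube Wilson probability measure (pattern of `wilsonMeasure`). -/
def cubeMeasure {N : ℕ} (ρ : G →* Matrix (Fin N) (Fin N) ℂ) (β : ℝ) (S R : ℕ) [NeZero S] :
    Measure (GaugeConfig 4 S G) :=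
  (cubeWeight ρ β S R Set.univ)⁻¹ • cubeWeight ρ β S R

/-- The change of `v = x₀ − x₁` along direction `i`: `+1, −1, 0, 0`. -/
def dv (i : Fin 4) : ℤ := if i = 0 then 1 else if i = 1 then -1 else 0

/-- Links of the CLOSED positive half of the free hypercube: inside `Q_R` without wrapping and both endpoints in
`{v ≥ 0}`, `v = x₀ − x₁` (integer representatives). -/
def PosHalfEdge (S R : ℕ) (e : Edge 4 S) : Prop :=
  (∀ μ : Fin 4, |rep S e.1 μ| ≤ (R : ℤ)) ∧ rep S e.1 e.2 + 1 ≤ (R : ℤ) ∧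
    0 ≤ rep S e.1 0 - rep S e.1 1 ∧ 0 ≤ rep S e.1 0 - rep S e.1 1 + dv e.2

/-- **Free-cube lattice `n`-point function** at step `k`: the integrand, box, spacing and renormalisations of
`latticeSchwinger` VERBATIM, integrated against the free-cube measure of half-side `R k` inside the scheme's torus
of side `2L_k+1` instead of the torus Wilson measure. -/
def cubeLatticeSchwinger {N : ℕ} {ι : Type} (ρ : G →* Matrix (Fin N) (Fin N) ℂ) (sch : SpeciesScheme ι)
    (R : ℕ → ℕ) (obs : ι → LGConfig 4 G → ℝ) (k : ℕ) (n : ℕ) (σ : Fin n → ι) (f : Fin n → 𝓢(E4, ℝ)) : ℝ :=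
  ∫ U, ∏ i, smearedLatticeField (obs (σ i)) (box 4 (sch.L k)) (sch.a k) (sch.c (σ i) k)
      (sch.m (σ i) k) (f i) (torusLift (sch.side k) U)
    ∂(cubeMeasure ρ (sch.β k) (sch.side k) (R k))

end Cube

/-! ## §2 Statements: S1a (fixed-volume cube swap-RP), the free-cube Gram pairing, THE LETTER S2 and its packaging -/

section Statements

variable (G : Type) [Group G] [TopologicalSpace G] [IsTopologicalGroup G] [CompactSpace G]
  [MeasurableSpace G] [BorelSpace G]

/-- **S1a `CubeHalfRP` (fixed volume).**  For a continuous unitary matrix representation `ρ`, `β ≥ 0`, a cube `Q_R` that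
does not wrap (`2R+1 ≤ S`), and every bounded measurable real `F` depending only on the links of the closed positive
half-cube, `0 ≤ ∫ F(Θ U) F(U) dμ_{Q_R}` with `Θ = configPerm (0 1)` the swap `x₀ ↔ x₁` of the torus
(`(Θ U)(x, i) = U(θx, σi)`).  Mechanism (proved in `…DiagonalMirrorRPRCubeHalfRP`): `LatticeRP.integral_mul_conj_mul_exp_nonneg_of_shared`
with shared block = the `e₂,e₃`-links on the mirror `v = 0`, positive block = the other closed-half links, no crossing links; the
plaquettes of `Q_R` are positive / mirrored / shared `(2,3)` at `v = 0` / bisected `(0,1)` at `v = 0` with `U_p = W₊ (W₊ ∘ θ)⁻¹`,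
`Re tr ρ(U_p) = Re ∑_{ab} ρ(W₊)_{ab} conj ρ(W₊ ∘ θ)_{ab}` (cf. `TiltedTorusSwapRP`, layer `0`). -/
def CubeHalfRP : Prop :=
  ∀ (N : ℕ) (ρ : G →* Matrix (Fin N) (Fin N) ℂ), Continuous ρ → (∀ g, ρ g ∈ Matrix.unitaryGroup (Fin N) ℂ) →
    ∀ (β : ℝ), 0 ≤ β → ∀ (S R : ℕ) [NeZero S], 2 * R + 1 ≤ S →
      ∀ (F : GaugeConfig 4 S G → ℝ) (B : ℝ), Measurable F → (∀ U, |F U| ≤ B) →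
        DependsOn F {e : Edge 4 S | PosHalfEdge S R e} →
          0 ≤ ∫ U, F (configPerm (Equiv.swap (0 : Fin 4) 1) U) * F U ∂(cubeMeasure ρ β S R)

variable {G}

/-- The free-cube swap Gram pairing of a reflected family at step `k` (cube of half-side `R k`): the interface's
`gramPairing r sch F k` with every torus `n`-point function replaced by its free-cube twin. -/
def cubeGramPairing (r : LatticeRep G) (sch : SpeciesScheme (YMSpecies G)) (R : ℕ → ℕ) (F : ReflectedFamily) (k : ℕ) : ℝ :=
  ∑ i, ∑ i', F.c i * F.c i' *
    cubeLatticeSchwinger r.ρ sch R (fun s => s.F) k (F.n i + F.n i') (fun _ => r.curvature) (Fin.append (F.σf i) (F.f i'))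

/-- **S2 — THE LETTER `CubeDecoupling` (locality / thermodynamic-limit insensitivity in PHYSICAL units, axis geometry).**
For every reflected family with pairwise disjoint supports (compact supports fixed in physical units, off-diagonal — exactly the
families of the socket `OddTorusSwapPairingLiminf`), the torus Gram pairing and the free-cube Gram pairing differ by `o(1)`: the
deleted boundary plaquettes, at physical distance `≥ a_k R_k − D → ∞` from the supports along some AXIS, do not influence the
renormalised local correlations in the limit.  Why it might fail: the rate must beat the renormalisation growth `c_k² ≤ a_k^{-2Q}`;
at weak coupling for non-abelian `G` no proof of boundary-influence decay in physical units exists (it is of infinite-volume-locality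
strength, uniform in boundary conditions — different in kind from the package's `L²` axis gap `RPSpectral`). -/
def CubeDecoupling (r : LatticeRep G) (sch : SpeciesScheme (YMSpecies G)) (R : ℕ → ℕ) : Prop :=
  ∀ F : ReflectedFamily,
    (∀ i (j j' : Fin (F.n i)), j ≠ j' → Disjoint (tsupport (F.f i j : E4 → ℝ)) (tsupport (F.f i j' : E4 → ℝ))) →
      Tendsto (fun k : ℕ => gramPairing r sch F k - cubeGramPairing r sch R F k) atTop (𝓝 0)

/-- **Packaging `AdmissibleCubeDecoupling`** (the letter as the door-C item carries it): some admissible radius sequence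
(cubes fit in the torus, `R_k ≤ L_k`, and grow without bound in physical units, `a_k R_k → ∞`) decouples. -/
def AdmissibleCubeDecoupling (r : LatticeRep G) (sch : SpeciesScheme (YMSpecies G)) : Prop :=
  ∃ R : ℕ → ℕ, (∀ k, R k ≤ sch.L k) ∧ Tendsto (fun k => sch.a k * (R k : ℝ)) atTop atTop ∧ CubeDecoupling r sch R

end Statements

end Summit.QuantumFields.YangMills.Cruxes.DiagonalMirrorRPR.CubeSurgery

end
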